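import Summits.QuantumAdvantage.QuantumAdvantage.Theorems.NearExactIsExact.Negative.CylinderSix

/-!
# `NearExactIsExact` (stmt-QuantumAdvantage-14043) — THEOREM AC: skew-AFFINE products over an
ARBITRARY frame bijection are never tight (disprover gen 38, DISPROOF §46.8)

The common generalisation of THEOREM A (`SkewProductResidual.skewProduct_residual_ne_flat`, gen 17:
any frame bijection `γ`, block TRANSLATIONS `w ↦ w ⊕ ρ(γ u)`) and THEOREM CYL6
(`CylinderSix.frameAffine_residual_ne_flat`, gen 36: `γ = id`, fibre-AFFINE blocks with affine
sections).  Frame `u ∈ 𝔽₂⁶`, block `w ∈ 𝔽₂^r` (any `r`), `π(u,w) = (γ u, P u w)` with `γ` ANY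
bijection of `𝔽₂⁶`, `P u 0 = ρ(γ u)` where `ρ` AND `ρ ∘ γ` are quadratic, and AFFINE sections
`y_k : 𝔽₂⁶ → 𝔽₂^r` with `P u (y_k u) = ρ(γ u) ⊕ e_k` (for `P u w = M(u)w ⊕ ρ(γ u)` this says
`u ↦ M(u)⁻¹` is affine); `c₁, c₂` cubic on `6 + r` bits.  Then the residual
`c₁(u,w) ⊕ c₂(γ u, P u w)` is never the flat indicator `[u = 0]`.

Proof = THEOREM A's parity count (`CylinderSix.core3`): `ĉ(v) := c₂(v, ρ v)` has
`ĉ ∘ γ = c₁(·,0) ⊕ [u = 0]`, of odd weight, while the Euler identity writes `Σ_v ĉ(v)` as a sum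
of even-weight terms because `ĉ_k ∘ γ = c₁(u, y_k u) ⊕ c₁(u, 0)` is cubic (affine sections) and
`(ρ_k ∘ γ)·(ĉ_k ∘ γ)` has degree `≤ 5 < 6`.

* `skewAffine_residual_ne_flat` — **THEOREM AC** (THEOREM CYL6 = the case `γ = id`, verbatim;
  THEOREM A = the case `P u w = w ⊕ ρ(γ u)`, `y_k = e_k`: `skewProduct_of_skewAffine`).

Use (paper, DISPROOF §46.8): in the open sub-stratum {naff(π) = 5, A = 0} of BQ-11 (normal form
`π(u,t) = (γ u, B(u) ⊕ M(u)t)`, `γ(u) = (ū, u₆ ⊕ g(ū))` an involution, `M(u)⁻¹ = M'(γ u)` with the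
affine matrix `M'` of `τ = π⁻¹`) the sub-case "`B ∘ γ` quadratic and `M` independent of `u₆`" is
empty (take `ρ = B ∘ γ`, `y_k(u) = M'(γ u) e_k`); THEOREM TT (`TwistedTranslation`) is the
complementary sub-case "`M` constant, `B` arbitrary".  Refuter-side structure (no positive Theses
statement is concluded); NOT summit progress.
-/

set_option linter.dupNamespace false -- D-0017: single-problem summit ⇒ `QuantumAdvantage.QuantumAdvantage` by design

namespace Summit.QuantumAdvantage.QuantumAdvantage.Theorems.NearExactIsExact.Negative.SkewAffine

open Finset
open Literature.Computability.QuantumComplexity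
open Literature.Computability.QuantumComplexity.BuzetChailloux (bxor)
open Summit.QuantumAdvantage.QuantumAdvantage.Theorems.CubicForrelation.NearExactIsExact
open Summit.QuantumAdvantage.QuantumAdvantage.Theorems.SignedExactCubicForrelationNotPrBPP.PolarGeometry
open Summit.QuantumAdvantage.QuantumAdvantage.Theorems.NearExactIsExact.Negative.SkewProductCore
open Summit.QuantumAdvantage.QuantumAdvantage.Theorems.NearExactIsExact.Negative.SkewProductResidual
open Summit.QuantumAdvantage.QuantumAdvantage.Theorems.NearExactIsExact.Negative.CylinderSix

variable {r : ℕ}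

/-- **THEOREM AC (gen 38).**  Frame `u ∈ 𝔽₂⁶`, block `w ∈ 𝔽₂^r`; `γ` ANY bijection of the frame;
block maps `P u` with `P u 0 = ρ(γ u)`, `ρ` and `ρ ∘ γ` quadratic; AFFINE sections `y_k` with
`P u (y_k u) = ρ(γ u) ⊕ e_k`; `c₁, c₂` cubic on `6 + r` bits.  Then `c₁(u,w) ⊕ c₂(γ u, P u w)` is
NOT the flat indicator `[u = 0]`.  (THEOREM A: `P u w = w ⊕ ρ(γ u)`, `y_k = e_k`; THEOREM CYL6:
`γ = id`.) [folklore] -/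
theorem skewAffine_residual_ne_flat {γ : (Fin 6 → Bool) → (Fin 6 → Bool)} (hγ : Function.Bijective γ)
    (P : (Fin 6 → Bool) → (Fin r → Bool) → (Fin r → Bool))
    (ρ : Fin r → (Fin 6 → Bool) → Bool) (hρ : ∀ k, IsDegLeFun 2 (ρ k))
    (hργ : ∀ k, IsDegLeFun 2 (fun u => ρ k (γ u)))
    (hP0 : ∀ u, P u (fun _ => false) = fun k => ρ k (γ u))
    (yk : Fin r → (Fin 6 → Bool) → (Fin r → Bool)) (hyk : ∀ k j, IsDegLeFun 1 (fun u => yk k u j))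
    (hPyk : ∀ k u, P u (yk k u) = fun j => (decide (j = k) ^^ ρ j (γ u)))
    (c₁ c₂ : (Fin (6 + r) → Bool) → Bool) (h₁ : IsDegLeFun 3 c₁) (h₂ : IsDegLeFun 3 c₂) :
    ¬ ∀ (u : Fin 6 → Bool) (w : Fin r → Bool),
      (c₁ (Fin.append u w) ^^ c₂ (Fin.append (γ u) (P u w))) = decide (∀ i, u i = false) := by
  intro h
  have hx : ∀ (u : Fin 6 → Bool) (w : Fin r → Bool),
      c₂ (Fin.append (γ u) (P u w)) = (c₁ (Fin.append u w) ^^ decide (∀ i, u i = false)) :=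
    fun u w => bool_solve _ _ _ (h u w)
  have h0 : ∀ u : Fin 6 → Bool,
      c₂ (Fin.append (γ u) (fun j => ρ j (γ u))) = (c₁ (emb r u) ^^ decide (∀ i, u i = false)) := by
    intro u
    have h' := hx u (fun _ => false)
    rw [hP0 u] at h'
    exact h'
  -- (ii) every `ĉ_k ∘ γ = c₁(·, y_k ·) ⊕ c₁(·, 0)` is cubic (affine sections)
  have hk : ∀ k, IsDegLeFun 3 (fun u => decide (tcoef ρ (coefC c₂) k (γ u) = 1)) := by
    intro k
    have e : (fun u => decide (tcoef ρ (coefC c₂) k (γ u) = 1)) =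
        fun u => (c₁ (emb r u) ^^ c₁ (Fin.append u (yk k u))) := by
      funext u
      rw [tcoef_eq, zmod2_decide_add, ← expand c₂ h₂, ← expand c₂ h₂, decide_ind_eq_one,
        decide_ind_eq_one, ← hPyk k u, hx u (yk k u), h0 u]
      exact bool_cancel _ _ _
    rw [e]
    exact fc_deg_bxor (fc_isDegLeFun_comp h₁ (emb r) (emb_coord_deg r) (by norm_num))
      (fc_isDegLeFun_comp h₁ (fun u => Fin.append u (yk k u)) (append_coord_deg (yk k) (hyk k))
        (by norm_num))
  -- so `ĉ` has even weight (sum over `v`, re-indexed along the bijection `γ`) ...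
  have hcore := core3 hγ hρ hργ (coefC_deg c₂ h₂) hk
  have hsum1 : ∑ u, ind (c₂ (Fin.append (γ u) (fun j => ρ j (γ u)))) = 0 := by
    rw [← hcore]
    simp_rw [expand c₂ h₂]
    exact Fintype.sum_bijective γ hγ _ _ (fun u => rfl)
  -- ... but (i) `ĉ ∘ γ = c₁(·,0) ⊕ 1_{u = 0}` has odd weight
  have hc₁ : ∑ u, ind (c₁ (emb r u)) = 0 :=
    sum_ind_eq_zero_of_deg_five (fc_isDegLeFun_comp h₁ (emb r) (emb_coord_deg r) (by norm_num))
  have hδ : ∑ u : Fin 6 → Bool, ind (decide (∀ i, u i = false)) = 1 := by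
    rw [Finset.sum_eq_single (fun _ => false)]
    · simp
    · intro u _ hu
      have hu' : ¬ ∀ i, u i = false := fun h' => hu (funext h')
      simp [hu']
    · intro h'
      exact absurd (mem_univ _) h'
  have hsum2 : ∑ u, ind (c₂ (Fin.append (γ u) (fun j => ρ j (γ u)))) = 1 := by
    simp_rw [h0, ind_xor]
    rw [sum_add_distrib, hc₁, hδ, zero_add]
  exact zero_ne_one (hsum1.symm.trans hsum2)

/-- THEOREM A is THEOREM AC for block translations `P u w = w ⊕ ρ(γ u)` with the constant sections
`y_k = e_k` (sanity / documentation). [folklore] -/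
theorem skewProduct_of_skewAffine {γ : (Fin 6 → Bool) → (Fin 6 → Bool)} (hγ : Function.Bijective γ)
    (ρ : Fin r → (Fin 6 → Bool) → Bool) (hρ : ∀ k, IsDegLeFun 2 (ρ k))
    (hργ : ∀ k, IsDegLeFun 2 (fun u => ρ k (γ u)))
    (c₁ c₂ : (Fin (6 + r) → Bool) → Bool) (h₁ : IsDegLeFun 3 c₁) (h₂ : IsDegLeFun 3 c₂) :
    ¬ ∀ (u : Fin 6 → Bool) (w : Fin r → Bool),
      (c₁ (Fin.append u w) ^^ c₂ (Fin.append (γ u) (fun k => w k ^^ ρ k (γ u)))) =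
        decide (∀ i, u i = false) := by
  refine skewAffine_residual_ne_flat hγ (fun u w => fun k => w k ^^ ρ k (γ u)) ρ hρ hργ
    (fun u => ?_) (fun k _ => fun j => decide (j = k)) (fun k j => ?_) (fun k u => ?_) c₁ c₂ h₁ h₂
  · funext k; exact Bool.false_xor _
  · exact isDegLeFun_const 1 _
  · rfl

end Summit.QuantumAdvantage.QuantumAdvantage.Theorems.NearExactIsExact.Negative.SkewAffine
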